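import Literature.MathematicalPhysics.QuantumLattice.PairFieldCarrierBound
import Literature.MathematicalPhysics.QuantumLattice.HubbardGroundStateDoublonBound
import HarnessLib

/-!
# The carrier ceiling on the `d_{x²-y²}` order parameter of Hubbard ground states, in the format of the summit `hubbard.S01`

Companion of `PairFieldCarrierBound` (for every `N`-particle torus state,
`Re ⟨ψ, Δ_d† Δ_d ψ⟩ ≤ 80 L² ((L² - N + 3)‖ψ‖² + 2 Re ⟨ψ, Σ_x n_{x↑}n_{x↓} ψ⟩)`) and of
`HubbardGroundStateDoublonBound` (sector ground states of `hubbardTorus 2 L 1 U` have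
`U ⟨N_d⟩ ≤ 4 N ‖ψ‖²`). Here the resulting bound is cast in the exact format of the order functional of
`Literature.Hubbard.DWaveSuperconductivityHubbard` (the summit `HubbardSuperconductivity`): if `N`, `ψ`
satisfy the summit's hypothesis clause for the coupling `U > 0` and the hole doping `δ ∈ (0, 1)`
(at every even side, `N L = 2⌊(1-δ)L²/2⌋`, `ψ L` a normalised sector ground state), then
`liminf_k |Λ_{2k}|⁻² Σ_{x,y ∈ Λ_{2k}} torusPullback (pairFieldCorr g_d ψ) (2k) x y ≤ 80 δ + 640/U`
(`liminf_dWavePairFieldCorr_le_carrier`). So every witness `(U, δ)` of the summit has order-parameter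
density at most `80 δ + 640/U`: the summit cannot be witnessed arbitrarily close to the Mott corner
`δ → 0`, `U → ∞` with a density bounded away from zero. Compare the kinematic ceiling `2(1 - δ²)`
(`PairFieldYangCeilingSummit`) and the weak-coupling ceiling `10⁵·U·log²(4 + 32/√U)`
(`HubbardPairDensityCouplingCeilingUniform`).

Sources: F. C. Zhang, C. Gros, T. M. Rice, H. Shiba, Supercond. Sci. Technol. 1 (1988) 36, §2 (the
Gutzwiller factor of the pair amplitude); H. Tasaki, J. Phys. Cond. Matt. 10 (1998) 4353, §5.1;
D. J. Scalapino, Phys. Rep. 250 (1995) 329, §2 eq. (2.4); S. Friedli, Y. Velenik (2017) §3.7.2 (LRO as a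
`liminf`). Proof-only; no definition, no named fact.
-/

namespace Literature.MathematicalPhysics.QuantumLattice

open Matrix Finset Filter
open Literature.Probability.LatticeModels
open scoped ComplexOrder

/-- **The carrier ceiling for Hubbard ground states, one side.** For `L ≥ 3`, `δ ∈ [0, 1]`, `U > 0` and
a normalised ground state `ψ` of `hubbardTorus 2 L 1 U` in the sector `(2⌊(1-δ)L²/2⌋, S^z = 0)`:
`Re ⟨ψ, Δ_d† Δ_d ψ⟩ ≤ 80 L² (δ L² + 5 + 8 L²/U)` (carrier bound + doublon bound + `N ≥ (1-δ)L² - 2`).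
Zhang–Gross–Rice–Shiba (1988) §2; Tasaki (1998) §5.1. [folklore] -/
theorem re_expect_pairField_dWave_le_carrier_of_groundState (L : ℕ) [NeZero L] (hL : 3 ≤ L)
    {δ U : ℝ} (hδ0 : 0 ≤ δ) (hδ1 : δ ≤ 1) (hU : 0 < U) {ψ : Fock (Orb (FermionTorus 2 L))}
    (hψ : IsGroundStateInSector (hubbardTorus 2 L 1 U) (2 * ⌊(1 - δ) * (L : ℝ) ^ 2 / 2⌋₊) 0 ψ)
    (h1 : star ψ ⬝ᵥ ψ = 1) :
    (star ψ ⬝ᵥ (((pairField dWaveFormFactor L)ᴴ * pairField dWaveFormFactor L) *ᵥ ψ)).re ≤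
      80 * (L : ℝ) ^ 2 * (δ * (L : ℝ) ^ 2 + 5 + 8 * (L : ℝ) ^ 2 / U) := by
  set n : ℕ := ⌊(1 - δ) * (L : ℝ) ^ 2 / 2⌋₊ with hn
  have hL2 : (0 : ℝ) ≤ (L : ℝ) ^ 2 := by positivity
  -- `N = 2n ∈ [(1-δ)L² - 2, (1-δ)L²]`
  have hy : 0 ≤ (1 - δ) * (L : ℝ) ^ 2 / 2 := by
    have : 0 ≤ 1 - δ := by linarith
    positivity
  have hNle : ((2 * n : ℕ) : ℝ) ≤ (1 - δ) * (L : ℝ) ^ 2 := by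
    have hfl := Nat.floor_le hy
    push_cast
    linarith
  have hNge : (1 - δ) * (L : ℝ) ^ 2 - 2 ≤ ((2 * n : ℕ) : ℝ) := by
    have hfl := Nat.lt_floor_add_one ((1 - δ) * (L : ℝ) ^ 2 / 2)
    push_cast
    linarith
  have h2n : 2 * n ≤ L ^ 2 := by
    have h : ((2 * n : ℕ) : ℝ) ≤ (L : ℝ) ^ 2 := by nlinarith
    exact_mod_cast h
  have hN : IsNParticle (2 * n) ψ := ((mem_szSector_iff (2 * n) 0 ψ).1 hψ.1).1
  have hcar := PairFieldCarrier.re_expect_pairField_dWave_conjTranspose_mul_le_carrier L hN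
  have hd := hubbardTorus_groundState_doublon_le L hL U h2n hψ
  rw [h1, Complex.one_re, mul_one] at hcar hd
  have hd' : 2 * (star ψ ⬝ᵥ ((∑ x : FermionTorus 2 L, numberOp x 0 * numberOp x 1 :
      Matrix (Finset (Orb (FermionTorus 2 L))) (Finset (Orb (FermionTorus 2 L))) ℂ) *ᵥ ψ)).re ≤
      8 * ((2 * n : ℕ) : ℝ) / U := by
    rw [le_div_iff₀ hU]
    nlinarith
  have hNU : 8 * ((2 * n : ℕ) : ℝ) / U ≤ 8 * (L : ℝ) ^ 2 / U := by
    refine div_le_div_of_nonneg_right ?_ hU.le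
    have : ((2 * n : ℕ) : ℝ) ≤ (L : ℝ) ^ 2 := by nlinarith
    linarith
  calc (star ψ ⬝ᵥ (((pairField dWaveFormFactor L)ᴴ * pairField dWaveFormFactor L) *ᵥ ψ)).re
      ≤ 80 * (L : ℝ) ^ 2 * (((L : ℝ) ^ 2 - ((2 * n : ℕ) : ℝ) + 3) +
          2 * (star ψ ⬝ᵥ ((∑ x : FermionTorus 2 L, numberOp x 0 * numberOp x 1 :
            Matrix (Finset (Orb (FermionTorus 2 L))) (Finset (Orb (FermionTorus 2 L))) ℂ) *ᵥ ψ)).re) := by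
        simpa using hcar
    _ ≤ 80 * (L : ℝ) ^ 2 * ((δ * (L : ℝ) ^ 2 + 5) + 8 * (L : ℝ) ^ 2 / U) := by
        gcongr 80 * (L : ℝ) ^ 2 * (?_ + ?_)
        · linarith
        · exact hd'.trans hNU
    _ = _ := by ring

/-- **The carrier ceiling on the summit's order functional.** Let `U > 0`, `δ ∈ (0, 1)`, and let
`N`, `ψ` satisfy the hypothesis clause of the summit statement
`Literature.Hubbard.DWaveSuperconductivityHubbard`: at every even side `L`, `N L = 2⌊(1-δ)L²/2⌋`,
`ψ L` is normalised and is a ground state of `hubbardTorus 2 L 1 U` in the sector `(N L, S^z = 0)`.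
Then the sequence whose `liminf` the summit asks to be positive obeys
`liminf_k |Λ_{2k}|⁻² Σ_{x,y ∈ Λ_{2k}} torusPullback (pairFieldCorr g_d ψ) (2k) x y ≤ 80 δ + 640/U`,
`Λ_{2k} = halfOpenBox 2 (2k)`: every witness `(U, δ)` of the summit has order-parameter density at most
`80 δ + 640/U`, which vanishes at the Mott corner `δ → 0`, `U → ∞`. (The `k`-th term is
`(2k)⁻⁴ Re ⟨ψ_{2k}, Δ_d† Δ_d ψ_{2k}⟩` by `torusLROSeq_pairFieldCorr_succ`, it is `≥ 0`, and by
`re_expect_pairField_dWave_le_carrier_of_groundState` it is `≤ 80δ + 640/U + 400/(2k)²`.)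
Zhang–Gross–Rice–Shiba (1988) §2; Tasaki (1998) §5.1; Scalapino, Phys. Rep. 250 (1995) 329, §2
eq. (2.4); Friedli–Velenik (2017) §3.7.2. [folklore] -/
theorem liminf_dWavePairFieldCorr_le_carrier {U δ : ℝ} (hU : 0 < U) (hδ0 : 0 ≤ δ) (hδ1 : δ ≤ 1)
    (N : ℕ → ℕ) (ψ : ∀ L, Fock (Orb (FermionTorus 2 L)))
    (hGS : ∀ L, Even L → N L = 2 * ⌊(1 - δ) * (L : ℝ) ^ 2 / 2⌋₊ ∧ star (ψ L) ⬝ᵥ ψ L = 1 ∧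
      IsGroundStateInSector (hubbardTorus 2 L 1 U) (N L) 0 (ψ L)) :
    liminf (fun k : ℕ => (∑ x ∈ halfOpenBox 2 (2 * k), ∑ y ∈ halfOpenBox 2 (2 * k),
        torusPullback (pairFieldCorr dWaveFormFactor ψ) (2 * k) x y) /
          ((#(halfOpenBox 2 (2 * k)) : ℝ)) ^ 2) atTop ≤
      80 * δ + 640 / U := by
  set C : ℝ := 80 * δ + 640 / U with hC
  set u : ℕ → ℝ := fun k => (∑ x ∈ halfOpenBox 2 (2 * k), ∑ y ∈ halfOpenBox 2 (2 * k),
      torusPullback (pairFieldCorr dWaveFormFactor ψ) (2 * k) x y) /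
        ((#(halfOpenBox 2 (2 * k)) : ℝ)) ^ 2 with hu
  change liminf u atTop ≤ C
  -- the `k`-th term for `k ≥ 1`, and its sign
  have hterm : ∀ k : ℕ, 1 ≤ k → ∃ n : ℕ, 2 * k = n + 1 ∧
      u k = (star (ψ (n + 1)) ⬝ᵥ (((pairField dWaveFormFactor (n + 1))ᴴ *
        pairField dWaveFormFactor (n + 1)) *ᵥ ψ (n + 1))).re / ((n + 1 : ℕ) : ℝ) ^ 4 := by
    intro k hk
    refine ⟨2 * k - 1, by omega, ?_⟩
    have e : 2 * k = (2 * k - 1) + 1 := by omega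
    simp only [hu]
    rw [e, torusLROSeq_pairFieldCorr_succ]
    rfl
  have hnonneg : ∀ k : ℕ, 1 ≤ k → 0 ≤ u k := by
    intro k hk
    obtain ⟨n, -, hn⟩ := hterm k hk
    rw [hn]
    refine div_nonneg ?_ (by positivity)
    exact (posSemidef_conjTranspose_mul_self (pairField dWaveFormFactor (n + 1))).re_dotProduct_nonneg
      (ψ (n + 1))
  have hbdd : IsBoundedUnder (· ≥ ·) atTop u :=
    isBoundedUnder_of_eventually_ge (a := 0)
      (Filter.eventually_atTop.2 ⟨1, fun k hk => hnonneg k hk⟩)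
  -- for every `c > C`, eventually `u k ≤ c`
  have hev : ∀ c : ℝ, C < c → ∀ᶠ k in atTop, u k ≤ c := by
    intro c hc
    have hε : 0 < c - C := by linarith
    rw [Filter.eventually_atTop]
    refine ⟨⌈400 / (c - C)⌉₊ + 2, fun k hk => ?_⟩
    obtain ⟨n, hn2, hn⟩ := hterm k (by omega)
    obtain ⟨hN, hnorm, hgs⟩ := hGS (n + 1) ⟨k, by omega⟩
    rw [hN] at hgs
    haveI : NeZero (n + 1) := ⟨by omega⟩
    have hL3 : 3 ≤ n + 1 := by omega
    have hside := re_expect_pairField_dWave_le_carrier_of_groundState (n + 1) hL3 hδ0 hδ1 hU hgs hnorm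
    have hL1 : (1 : ℝ) ≤ ((n + 1 : ℕ) : ℝ) := by exact_mod_cast (show 1 ≤ n + 1 by omega)
    have hL2 : (0 : ℝ) < ((n + 1 : ℕ) : ℝ) ^ 2 := by positivity
    have hLk : (⌈400 / (c - C)⌉₊ : ℝ) + 2 ≤ ((n + 1 : ℕ) : ℝ) := by
      have : ⌈400 / (c - C)⌉₊ + 2 ≤ n + 1 := by omega
      exact_mod_cast this
    have hceil : 400 / (c - C) ≤ (⌈400 / (c - C)⌉₊ : ℝ) := Nat.le_ceil _
    have hdiv : 400 / (c - C) < ((n + 1 : ℕ) : ℝ) := by linarith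
    have h4 : 400 < (c - C) * ((n + 1 : ℕ) : ℝ) := by
      have := (div_lt_iff₀ hε).1 hdiv
      linarith
    rw [hn, div_le_iff₀ (by positivity)]
    refine hside.trans ?_
    -- `80 L² (δ L² + 5 + 8 L²/U) = C L⁴ + 400 L² ≤ c L⁴` for `L = n + 1 ≥ ⌈400/(c-C)⌉ + 2`
    have hsq : ((n + 1 : ℕ) : ℝ) ^ 4 = ((n + 1 : ℕ) : ℝ) ^ 2 * ((n + 1 : ℕ) : ℝ) ^ 2 := by ring
    have hexp : 80 * ((n + 1 : ℕ) : ℝ) ^ 2 * (δ * ((n + 1 : ℕ) : ℝ) ^ 2 + 5 + 8 * ((n + 1 : ℕ) : ℝ) ^ 2 / U) =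
        C * (((n + 1 : ℕ) : ℝ) ^ 2 * ((n + 1 : ℕ) : ℝ) ^ 2) + 400 * ((n + 1 : ℕ) : ℝ) ^ 2 := by
      simp only [hC]
      ring
    rw [hsq, hexp]
    nlinarith [mul_le_mul_of_nonneg_right hL1 hL2.le]
  -- conclude
  by_contra hlt
  push Not at hlt
  have hmid : C < (C + liminf u atTop) / 2 := by linarith
  have h := liminf_le_of_frequently_le ((hev _ hmid).frequently) hbdd
  linarith

end Literature.MathematicalPhysics.QuantumLattice
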